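import Mathlib
import HarnessLib
import Summits.Ventures.LatticeQCDFlow.Exactness.NCMCGeneralSpaceKernel
import Summits.Ventures.LatticeQCDFlow.Exactness.NCMCGeneralSpaceOccupancy
import Summits.Ventures.LatticeQCDFlow.Exactness.NCMCGeneralSpaceMarkovRun

/-!
# The NCMC lane's occupancy chain: along the expanded-ensemble chain the occupancy of the target level, `dF_occ` and the target-level averages are consistent

HONEST FRAMING: exact (Metropolis-corrected) sampling algorithms for lattice gauge theory;
figures of merit are autocorrelation/cost numbers at stated couplings and volumes; no
continuum-physics claim.

Venture `LatticeQCDFlow` (cell pub-lqcd), topic `Exactness`; FANOUT row 13 (`eng-snf`, GEN-17).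
NEW WORK of the cell, not a published result; no definition is introduced; nothing is cited as a
fact (Birkhoff's pointwise ergodic theorem enters through `NCMCGeneralSpaceErgodicRun.lean` as a
tree-PROVED fact).  Named only: Nilmeier–Crooks–Minh–Chodera 2011 (NCMC); the expanded-ensemble
reading (a chain on `{levels} × Ω`) is Lyubartsev et al. 1992 in spirit.

WHY.  GEN-9/GEN-11 typed the `correction = ncmc-metropolis` mode of `latflow-snf` (≥ 0.1.9,
`snf.ncmc.run_ncmc_chain`) IN POPULATION: the joint weight
`Π_c = ν₀ ⊗ δ_prior + e^{c} ν₁ ⊗ δ_target` on `Bool × Ω` is invariant under the Metropolized switch of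
every Crooks pair and under level-wise relaxation (`NCMCGeneralSpaceKernel.switchKernel_invariant`,
`iteration_invariant`), and the stationary occupancy of the target level is `σ(c − ΔF)`
(`NCMCGeneralSpaceOccupancy.occupancy_eq_sigmoid`, `log_occupancy_div_eq`).  What the engine REPORTS
are time averages along ONE run of the chain: `meta.occupancy_target` (the fraction of iterations
spent on the target level), `dF_occ = c − logit(occupancy)`, and plain averages of observables over
the target-level visits.  GEN-16 typed the sampling theory of the Jarzynski / reweighting lane along
one stationary (ergodic) stream; THIS file does the same for the NCMC lane's own chain.

## Setting

`Ω` measurable; finite level weights `ν₀, ν₁` with `Z₀ = ν₀(Ω) ≠ 0` (and `Z₁ = ν₁(Ω) ≠ 0` where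
`ΔF` is read); a constant `c`; ANY Markov kernel `Q` on `Bool × Ω` leaving `Π_c = jointWeight c ν₀ ν₁`
invariant (one iteration of the engine: `switchKernel κF κR c W s e ∘ₖ levelKernel T₀ T₁` by
`iteration_invariant`, or any other composition of exact moves); the chain is Mathlib's
Ionescu-Tulcea law `Kernel.trajMeasure` of `Q` started in the normalised joint law
`π_c = Π_c(everything)⁻¹ • Π_c` (row 8's object, as in `NCMCGeneralSpaceMarkovRun.lean`).

## Content

* `isFiniteMeasure_jointWeight`, `jointWeight_univ_ne_zero`, `isProbabilityMeasure_jointLaw`,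
  **`jointLaw_real_targetLevel`** (`π_c(target level) = σ(c − ΔF)`),
  `integral_jointLaw_targetLevel_indicator`, `variance_jointLaw_targetLevel_indicator` (`σ(1 − σ)`)
  — bookkeeping for the normalised joint law.
* **`integral_occupancy_chain`** — STATIONARITY ALONE: the reported occupancy is unbiased at every
  `n ≥ 1`, `E[(1/n) #{i < n : level_i = target}] = σ(c − ΔF)`, whatever the autocorrelations.
* **`variance_occupancy_chain`** — and its variance is `2 τ_n(ρ_occ) σ(1 − σ)/n` EXACTLY, `ρ_occ` the
  autocorrelation of the level-indicator series along the chain, `τ_n` row 11's `Scoring.tauIntN`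
  (`NCMCGeneralSpaceStationaryRun.variance_sum_div_eq_tauIntN_of_stationary`): the honest number of
  independent level readings behind `meta.occupancy_target` is `n/(2 τ_n(ρ_occ))`.
* **`tendsto_occupancy_ae_chain`** — IF the chain is ergodic for the shift: the occupancy fraction
  converges to `σ(c − ΔF)` almost surely;
  **`tendsto_dFocc_ae_chain`** — hence `dF_occ,n = c − log(p̂_n/(1 − p̂_n)) → ΔF` almost surely (the
  engine's occupancy estimator of the free-energy difference is strongly consistent, for EVERY `c`).

Companion `NCMCGeneralSpaceOccupancyChainMeans.lean`: the plain averages of an observable over the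
target-level (prior-level) visits converge to the normalised target (prior) expectations.  The
ergodicity hypothesis is discharged for the engine's iteration kernel from a minorisation of the two
level samplers in `NCMCGeneralSpaceOccupancyChainErgodic.lean`.  NOT CLAIMED: rates, error bars
beyond the exact variance identity, anything about a concrete protocol's acceptances.
-/

namespace Summit.Ventures.LatticeQCDFlow.Exactness.GeneralNCMC

open MeasureTheory ProbabilityTheory Set Filter Finset
open scoped ENNReal Topology

variable {Ω : Type*} [MeasurableSpace Ω]

/-! ## The normalised joint law `π_c` -/

section JointLaw

variable (c : ℝ) (ν₀ ν₁ : Measure Ω)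

/-- The joint weight of finite level weights is finite: `Π_c(everything) = Z₀ + e^{c} Z₁ < ∞`. -/
theorem isFiniteMeasure_jointWeight [IsFiniteMeasure ν₀] [IsFiniteMeasure ν₁] :
    IsFiniteMeasure (jointWeight c ν₀ ν₁) := by
  refine ⟨?_⟩
  rw [jointWeight_univ]
  exact ENNReal.add_lt_top.2 ⟨measure_lt_top _ _,
    ENNReal.mul_lt_top ENNReal.ofReal_lt_top (measure_lt_top _ _)⟩

/-- The joint weight is non-zero as soon as the prior weight is. -/
theorem jointWeight_univ_ne_zero (h0 : ν₀ univ ≠ 0) : jointWeight c ν₀ ν₁ univ ≠ 0 := by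
  rw [jointWeight_univ]
  exact ne_of_gt (lt_of_lt_of_le (pos_iff_ne_zero.2 h0) le_self_add)

/-- The normalised joint law `π_c = Π_c(everything)⁻¹ • Π_c` is a probability law. -/
theorem isProbabilityMeasure_jointLaw [IsFiniteMeasure ν₀] [IsFiniteMeasure ν₁] (h0 : ν₀ univ ≠ 0) :
    IsProbabilityMeasure ((jointWeight c ν₀ ν₁ univ)⁻¹ • jointWeight c ν₀ ν₁) := by
  haveI := isFiniteMeasure_jointWeight c ν₀ ν₁
  exact ⟨by rw [Measure.smul_apply, smul_eq_mul,
    ENNReal.inv_mul_cancel (jointWeight_univ_ne_zero c ν₀ ν₁ h0) (measure_ne_top _ _)]⟩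

/-- **The occupancy law, probability form**: `π_c(target level) = σ(c − ΔF)`. -/
theorem jointLaw_real_targetLevel [IsFiniteMeasure ν₀] [IsFiniteMeasure ν₁] (h0 : ν₀ univ ≠ 0)
    (h1 : ν₁ univ ≠ 0) {ΔF : ℝ} (hΔF : Real.exp (-ΔF) = ((ν₀ univ)⁻¹ * ν₁ univ).toReal) :
    ((jointWeight c ν₀ ν₁ univ)⁻¹ • jointWeight c ν₀ ν₁).real (targetLevel Ω) =
      Real.sigmoid (c - ΔF) := by
  rw [← occupancy_eq_sigmoid c ν₀ ν₁ h0 h1 hΔF, measureReal_def, Measure.smul_apply, smul_eq_mul,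
    ENNReal.toReal_mul, ENNReal.toReal_inv, inv_mul_eq_div]

/-- Integrals against the joint weight split by level (real form):
`∫ f dΠ_c = ∫ f(prior, x) dν₀ + e^{c} ∫ f(target, y) dν₁` for `f` measurable and integrable on each
level. -/
theorem integral_jointLaw_targetLevel_indicator [IsFiniteMeasure ν₀] [IsFiniteMeasure ν₁]
    (h0 : ν₀ univ ≠ 0) (h1 : ν₁ univ ≠ 0) {ΔF : ℝ}
    (hΔF : Real.exp (-ΔF) = ((ν₀ univ)⁻¹ * ν₁ univ).toReal) :
    ∫ p, (targetLevel Ω).indicator (1 : Bool × Ω → ℝ) p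
        ∂((jointWeight c ν₀ ν₁ univ)⁻¹ • jointWeight c ν₀ ν₁) = Real.sigmoid (c - ΔF) := by
  rw [integral_indicator_one measurableSet_targetLevel, jointLaw_real_targetLevel c ν₀ ν₁ h0 h1 hΔF]

/-- The level indicator is square integrable under `π_c` (it is bounded by one). -/
theorem memLp_targetLevel_indicator :
    MemLp ((targetLevel Ω).indicator (1 : Bool × Ω → ℝ)) 2
      ((jointWeight c ν₀ ν₁ univ)⁻¹ • jointWeight c ν₀ ν₁) := by
  refine MemLp.of_bound ((measurable_one.indicator measurableSet_targetLevel).aestronglyMeasurable)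
    1 (Eventually.of_forall fun p => ?_)
  by_cases hp : p ∈ targetLevel Ω
  · simp [Set.indicator_of_mem hp]
  · simp [Set.indicator_of_notMem hp]

/-- The level indicator has variance `σ(1 − σ)` under `π_c`, `σ = σ(c − ΔF)` (a Bernoulli variable). -/
theorem variance_jointLaw_targetLevel_indicator [IsFiniteMeasure ν₀] [IsFiniteMeasure ν₁]
    (h0 : ν₀ univ ≠ 0) (h1 : ν₁ univ ≠ 0) {ΔF : ℝ}
    (hΔF : Real.exp (-ΔF) = ((ν₀ univ)⁻¹ * ν₁ univ).toReal) :
    Var[(targetLevel Ω).indicator (1 : Bool × Ω → ℝ);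
        (jointWeight c ν₀ ν₁ univ)⁻¹ • jointWeight c ν₀ ν₁] =
      Real.sigmoid (c - ΔF) * (1 - Real.sigmoid (c - ΔF)) := by
  haveI := isProbabilityMeasure_jointLaw c ν₀ ν₁ h0
  have hsq : (targetLevel Ω).indicator (1 : Bool × Ω → ℝ) ^ 2 =
      (targetLevel Ω).indicator (1 : Bool × Ω → ℝ) := by
    funext p
    by_cases hp : p ∈ targetLevel Ω
    · simp [Set.indicator_of_mem hp]
    · simp [Set.indicator_of_notMem hp]
  rw [variance_eq_sub (memLp_targetLevel_indicator c ν₀ ν₁), hsq,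
    integral_jointLaw_targetLevel_indicator c ν₀ ν₁ h0 h1 hΔF]
  ring

end JointLaw

/-! ## The occupancy chain: what stationarity gives -/

section Chain

variable {c : ℝ} {ν₀ ν₁ : Measure Ω} [IsFiniteMeasure ν₀] [IsFiniteMeasure ν₁]
variable (Q : Kernel (Bool × Ω) (Bool × Ω)) [IsMarkovKernel Q]

/-- **THE REPORTED OCCUPANCY IS UNBIASED AT EVERY `n ≥ 1`.**  Along the expanded-ensemble chain of
any `Π_c`-invariant Markov kernel started in `π_c`, the expected fraction of the first `n` iterations
spent on the target level is `σ(c − ΔF)` — stationarity alone, whatever the autocorrelations. -/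
theorem integral_occupancy_chain (h0 : ν₀ univ ≠ 0) (h1 : ν₁ univ ≠ 0)
    (hQ : Kernel.Invariant Q (jointWeight c ν₀ ν₁)) {ΔF : ℝ}
    (hΔF : Real.exp (-ΔF) = ((ν₀ univ)⁻¹ * ν₁ univ).toReal) {n : ℕ} (hn : n ≠ 0) :
    haveI := isProbabilityMeasure_jointLaw c ν₀ ν₁ h0
    ∫ z, (∑ i ∈ range n, (targetLevel Ω).indicator (1 : Bool × Ω → ℝ) (z i)) / n
      ∂(Kernel.trajMeasure (X := fun _ : ℕ => Bool × Ω)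
        ((jointWeight c ν₀ ν₁ univ)⁻¹ • jointWeight c ν₀ ν₁)
        (fun n : ℕ => Q.comap (fun h : (j : ↥(Finset.Iic n)) → Bool × Ω =>
          h ⟨n, Finset.mem_Iic.2 le_rfl⟩) (measurable_pi_apply _))) = Real.sigmoid (c - ΔF) := by
  haveI := isProbabilityMeasure_jointLaw c ν₀ ν₁ h0
  rw [integral_sum_div_chain Q (invariant_smul Q hQ _)
    ((memLp_targetLevel_indicator c ν₀ ν₁).integrable one_le_two) hn,
    integral_jointLaw_targetLevel_indicator c ν₀ ν₁ h0 h1 hΔF]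

/-- **ITS VARIANCE IS `2 τ_n(ρ_occ) σ(1 − σ)/n` EXACTLY** (`σ = σ(c − ΔF) ∉ {0, 1}`), `ρ_occ` the
autocorrelation of the level-indicator series along the chain and `τ_n` row 11's Fejér-weighted
`Scoring.tauIntN`: the honest number of independent level readings behind the reported occupancy is
`n/(2 τ_n(ρ_occ))`. -/
theorem variance_occupancy_chain (h0 : ν₀ univ ≠ 0) (h1 : ν₁ univ ≠ 0)
    (hQ : Kernel.Invariant Q (jointWeight c ν₀ ν₁)) {ΔF : ℝ}
    (hΔF : Real.exp (-ΔF) = ((ν₀ univ)⁻¹ * ν₁ univ).toReal) {n : ℕ} (hn : n ≠ 0) :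
    haveI := isProbabilityMeasure_jointLaw c ν₀ ν₁ h0
    Var[fun z : ℕ → Bool × Ω => (∑ i ∈ range n, (targetLevel Ω).indicator (1 : Bool × Ω → ℝ) (z i)) / n;
      Kernel.trajMeasure (X := fun _ : ℕ => Bool × Ω)
        ((jointWeight c ν₀ ν₁ univ)⁻¹ • jointWeight c ν₀ ν₁)
        (fun n : ℕ => Q.comap (fun h : (j : ↥(Finset.Iic n)) → Bool × Ω =>
          h ⟨n, Finset.mem_Iic.2 le_rfl⟩) (measurable_pi_apply _))] =
      2 * Scoring.tauIntN (fun t =>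
          cov[fun z : ℕ → Bool × Ω => (targetLevel Ω).indicator (1 : Bool × Ω → ℝ) (z 0),
            fun z : ℕ → Bool × Ω => (targetLevel Ω).indicator (1 : Bool × Ω → ℝ) (z t);
            Kernel.trajMeasure (X := fun _ : ℕ => Bool × Ω)
              ((jointWeight c ν₀ ν₁ univ)⁻¹ • jointWeight c ν₀ ν₁)
              (fun n : ℕ => Q.comap (fun h : (j : ↥(Finset.Iic n)) → Bool × Ω =>
                h ⟨n, Finset.mem_Iic.2 le_rfl⟩) (measurable_pi_apply _))] /
          (Real.sigmoid (c - ΔF) * (1 - Real.sigmoid (c - ΔF)))) n *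
        (Real.sigmoid (c - ΔF) * (1 - Real.sigmoid (c - ΔF))) / n := by
  haveI := isProbabilityMeasure_jointLaw c ν₀ ν₁ h0
  have hσ : Real.sigmoid (c - ΔF) * (1 - Real.sigmoid (c - ΔF)) ≠ 0 :=
    mul_ne_zero (Real.sigmoid_pos _).ne' (sub_ne_zero.2 (Real.sigmoid_lt_one _).ne')
  have hvar := variance_jointLaw_targetLevel_indicator c ν₀ ν₁ h0 h1 hΔF
  have key := variance_sum_div_eq_tauIntN_of_stationary
    (measurePreserving_shift_chain Q (invariant_smul Q hQ _))
    (chain_map_eval_of_invariant Q (invariant_smul Q hQ _) 0)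
    (memLp_targetLevel_indicator c ν₀ ν₁) (by rw [hvar]; exact hσ) hn
  rw [hvar] at key
  exact key

/-! ## The occupancy chain: what ergodicity gives -/

/-- **STRONG CONSISTENCY OF THE REPORTED OCCUPANCY.**  If the expanded-ensemble chain is ergodic for
the shift (a property of the iteration kernel — certified from the level samplers in
`NCMCGeneralSpaceOccupancyChainErgodic.lean`), the fraction of iterations spent on the target level
converges to `σ(c − ΔF)` almost surely. -/
theorem tendsto_occupancy_ae_chain (h0 : ν₀ univ ≠ 0) (h1 : ν₁ univ ≠ 0)
    (hQ : Kernel.Invariant Q (jointWeight c ν₀ ν₁)) {ΔF : ℝ}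
    (hΔF : Real.exp (-ΔF) = ((ν₀ univ)⁻¹ * ν₁ univ).toReal)
    (hErg : haveI := isProbabilityMeasure_jointLaw c ν₀ ν₁ h0
      Ergodic (fun (z : ℕ → Bool × Ω) (k : ℕ) => z (k + 1))
        (Kernel.trajMeasure (X := fun _ : ℕ => Bool × Ω)
          ((jointWeight c ν₀ ν₁ univ)⁻¹ • jointWeight c ν₀ ν₁)
          (fun n : ℕ => Q.comap (fun h : (j : ↥(Finset.Iic n)) → Bool × Ω =>
            h ⟨n, Finset.mem_Iic.2 le_rfl⟩) (measurable_pi_apply _)))) :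
    haveI := isProbabilityMeasure_jointLaw c ν₀ ν₁ h0
    ∀ᵐ z ∂(Kernel.trajMeasure (X := fun _ : ℕ => Bool × Ω)
        ((jointWeight c ν₀ ν₁ univ)⁻¹ • jointWeight c ν₀ ν₁)
        (fun n : ℕ => Q.comap (fun h : (j : ↥(Finset.Iic n)) → Bool × Ω =>
          h ⟨n, Finset.mem_Iic.2 le_rfl⟩) (measurable_pi_apply _))),
      Tendsto (fun n : ℕ => (∑ i ∈ range n, (targetLevel Ω).indicator (1 : Bool × Ω → ℝ) (z i)) / n)
        atTop (𝓝 (Real.sigmoid (c - ΔF))) := by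
  haveI := isProbabilityMeasure_jointLaw c ν₀ ν₁ h0
  have h := tendsto_sum_div_ae_chain Q hErg (invariant_smul Q hQ _)
    ((memLp_targetLevel_indicator c ν₀ ν₁).integrable one_le_two)
  rw [integral_jointLaw_targetLevel_indicator c ν₀ ν₁ h0 h1 hΔF] at h
  exact h

/-- **STRONG CONSISTENCY OF `dF_occ`.**  Along an ergodic expanded-ensemble chain the engine's
occupancy estimator of the free-energy difference, `dF_occ,n = c − log(p̂_n / (1 − p̂_n))` with `p̂_n`
the occupancy fraction of the first `n` iterations, converges to `ΔF` almost surely — for EVERY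
constant `c` (its value costs statistics, never consistency). -/
theorem tendsto_dFocc_ae_chain (h0 : ν₀ univ ≠ 0) (h1 : ν₁ univ ≠ 0)
    (hQ : Kernel.Invariant Q (jointWeight c ν₀ ν₁)) {ΔF : ℝ}
    (hΔF : Real.exp (-ΔF) = ((ν₀ univ)⁻¹ * ν₁ univ).toReal)
    (hErg : haveI := isProbabilityMeasure_jointLaw c ν₀ ν₁ h0
      Ergodic (fun (z : ℕ → Bool × Ω) (k : ℕ) => z (k + 1))
        (Kernel.trajMeasure (X := fun _ : ℕ => Bool × Ω)
          ((jointWeight c ν₀ ν₁ univ)⁻¹ • jointWeight c ν₀ ν₁)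
          (fun n : ℕ => Q.comap (fun h : (j : ↥(Finset.Iic n)) → Bool × Ω =>
            h ⟨n, Finset.mem_Iic.2 le_rfl⟩) (measurable_pi_apply _)))) :
    haveI := isProbabilityMeasure_jointLaw c ν₀ ν₁ h0
    ∀ᵐ z ∂(Kernel.trajMeasure (X := fun _ : ℕ => Bool × Ω)
        ((jointWeight c ν₀ ν₁ univ)⁻¹ • jointWeight c ν₀ ν₁)
        (fun n : ℕ => Q.comap (fun h : (j : ↥(Finset.Iic n)) → Bool × Ω =>
          h ⟨n, Finset.mem_Iic.2 le_rfl⟩) (measurable_pi_apply _))),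
      Tendsto (fun n : ℕ => c - Real.log
          ((∑ i ∈ range n, (targetLevel Ω).indicator (1 : Bool × Ω → ℝ) (z i)) / n /
            (1 - (∑ i ∈ range n, (targetLevel Ω).indicator (1 : Bool × Ω → ℝ) (z i)) / n)))
        atTop (𝓝 ΔF) := by
  haveI := isProbabilityMeasure_jointLaw c ν₀ ν₁ h0
  -- in population: `c − log(σ/(1 − σ)) = ΔF`
  have hpop := log_occupancy_div_eq c ν₀ ν₁ h0 h1 hΔF
  rw [occupancy_eq_sigmoid c ν₀ ν₁ h0 h1 hΔF] at hpop
  have hσ0 : 0 < Real.sigmoid (c - ΔF) := Real.sigmoid_pos _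
  have hσ1 : 1 - Real.sigmoid (c - ΔF) ≠ 0 := sub_ne_zero.2 (Real.sigmoid_lt_one _).ne'
  have hquot : Real.sigmoid (c - ΔF) / (1 - Real.sigmoid (c - ΔF)) ≠ 0 :=
    div_ne_zero hσ0.ne' hσ1
  filter_upwards [tendsto_occupancy_ae_chain Q h0 h1 hQ hΔF hErg] with z hz
  have hlim : Tendsto (fun n : ℕ => c - Real.log
      ((∑ i ∈ range n, (targetLevel Ω).indicator (1 : Bool × Ω → ℝ) (z i)) / n /
        (1 - (∑ i ∈ range n, (targetLevel Ω).indicator (1 : Bool × Ω → ℝ) (z i)) / n)))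
      atTop (𝓝 (c - Real.log (Real.sigmoid (c - ΔF) / (1 - Real.sigmoid (c - ΔF))))) :=
    tendsto_const_nhds.sub ((hz.div (tendsto_const_nhds.sub hz) hσ1).log hquot)
  rw [hpop, sub_sub_cancel] at hlim
  exact hlim

end Chain

end Summit.Ventures.LatticeQCDFlow.Exactness.GeneralNCMC
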